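import Literature.Probability.Percolation.FKLoopNestingGaussianLimit
import Literature.GroupTheory.CombinatorialGroupTheory.CommutatorLength
import Mathlib.Analysis.Complex.Trigonometric
import HarnessLib

/-!
# The Baxter–Kelland–Wu orientation expansion: products over loops as sums over arrow configurations

The algebraic core of the Baxter–Kelland–Wu correspondence between the loop representation of the
planar random-cluster model and the six-vertex model (Baxter–Kelland–Wu 1976, §3–§4; in the form
used by Duminil-Copin–Kozlowski–Lammers–Manolescu 2026, §3.2, identity (3.2), behind their Cor. 10
= `dklm2026_corollary10`), isolated from all lattice geometry. The loops of a configuration are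
the cycles of a permutation `σ` of a finite set `C` of "corners" (directed medial edges; on `ℤ²`,
`σ` is the turning rule `cornerPerm`, and the loops of a finite piece are the cycles of its
restriction, `FKFreeLoopRepresentation.pieceCornerPerm`). An **arrow configuration** is a map
`s : C → Bool` (each medial edge oriented along its corner or against it), and the arrow
configurations obtained by orienting every loop one way or the other are exactly the
`σ`-invariant ones. Everything here is PROVED finite algebra; no named fact is introduced.

* `prod_cycles_two_cos_eq_sum_invariant` — **orientation expansion over cycles**: for every
  `g : C → ℝ`,
  `∏_{S cycle of σ} 2 cos(∑_{c ∈ S} g c) = ∑_{s : C → Bool, s ∘ σ = s} ∏_{c} exp(i ε(s c) g c)`,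
  `ε(true) = 1`, `ε(false) = -1` (each loop is summed over its two orientations, and an
  orientation of all loops is an invariant arrow configuration).
* `two_cos_eq_sqrt_mul_cosMu` — with `g c = λ t(c)/4 + κ(c)`, `λ = arccos(√q/2) = 2πμ`, and the
  quarter turns `t` of a loop summing to `±4` (the Umlaufsatz, `medialCycle_turning` /
  `MedialTrailUmlaufsatz.inv_cornerOrbit` on `ℤ²`), each factor is DKLM's twisted loop weight:
  `2 cos(∑_{c∈S} g c) = √q · cos_μ(τ_S ∑_{c∈S} κ c)`, `τ_S = (∑_{c∈S} t c)/4 = ±1` the sense of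
  rotation of the loop (`cos λ = √q/2`: the loop weight `√q = e^{iλ} + e^{-iλ}` is the sum over
  the two orientations of `e^{iλ · (turning number)}`).
* `bkw_configuration_sum` — summing over configurations `ξ` (with loops `σ_ξ`, turns `t_ξ`):
  `∑_ξ √q^{#loops(ξ)} ∏_{S} cos_μ(τ_S θ̃_S) = ∑_{s : C → Bool} W(s) · exp(i ∑_c ε(s c) κ c)`,
  `θ̃_S = ∑_{c∈S} κ c`, with the **six-vertex weight**
  `W(s) = ∑_{ξ : s ∘ σ_ξ = s} ∏_c exp(i ε(s c) λ t_ξ(c)/4)` (`bkwWeight`) — the partition of the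
  loop observable `∏ cos_μ` into an arrow-configuration observable times a weight collecting the
  local turn phases `e^{± iλ/4}`; on `ℤ²` the latter is the product of the six-vertex vertex
  weights `1, 1, 1, 1, c, c`, `c = 2cos(λ/2) = √(2 + √q)` (and boundary phases), computed where
  the lattice structure is available.

## References

* R. J. Baxter, S. B. Kelland, F. Y. Wu, *Equivalence of the Potts model or Whitney polynomial
  with an ice-type model*, J. Phys. A 9 (1976) 397–406, §3–§4 (orient the polygons; weight
  `z^{±1/4}` per turn, `q^{1/2} = z + z^{-1}`). [BaxterKellandWu1976]
* H. Duminil-Copin, K. K. Kozlowski, P. Lammers, I. Manolescu, arXiv:2603.06268 (2026), §3.2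
  (`μ`, `cos_μ`, identity (3.2)). [DuminilCopinKozlowskiLammersManolescu2026]
-/

noncomputable section

open Complex Finset Equiv
open scoped Real

namespace Literature.Probability.Percolation.BKW

open Literature.GroupTheory.CombinatorialGroupTheory

variable {C : Type*} [Fintype C] [DecidableEq C]

/-! ### Arrow signs, cycles, invariant arrow configurations -/

/-- The sign `ε(b) = ±1` of an arrow bit (`true` = along the corner). [cite: BaxterKellandWu1976, §3] -/
def sgn (b : Bool) : ℤ := if b then 1 else -1

/-- The cycles (loops) of a permutation of a finite type, as finsets (fixed points give
singletons); their number is `PairingGenus.ncl`. [folklore] -/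
abbrev cycles (σ : Perm C) : Finset (Finset C) := univ.image (PairingGenus.cls σ)

/-- The number of cycles is the cardinality of `cycles`. [folklore] -/
theorem ncl_eq_card_cycles (σ : Perm C) : PairingGenus.ncl σ = #(cycles σ) := rfl

/-- The cycle of `c` is a cycle. [folklore] -/
theorem cls_mem_cycles (σ : Perm C) (c : C) : PairingGenus.cls σ c ∈ cycles σ :=
  mem_image_of_mem _ (mem_univ c)

/-- The fibre of `cls σ` over a cycle is that cycle. [folklore] -/
theorem filter_cls_eq {σ : Perm C} {S : Finset C} (hS : S ∈ cycles σ) :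
    (univ.filter fun c ↦ PairingGenus.cls σ c = S) = S := by
  obtain ⟨c₀, -, rfl⟩ := mem_image.1 hS
  ext c
  rw [mem_filter, PairingGenus.mem_cls, PairingGenus.cls_eq_cls_iff]
  simp only [mem_univ, true_and]
  exact ⟨fun h ↦ h.symm, fun h ↦ h.symm⟩

omit [DecidableEq C] in
/-- **A `σ`-invariant arrow configuration is constant on cycles.** [cite: BaxterKellandWu1976, §3] -/
theorem apply_eq_of_sameCycle {σ : Perm C} {s : C → Bool} (hs : ∀ c, s (σ c) = s c) {x y : C}
    (h : σ.SameCycle x y) : s x = s y := by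
  obtain ⟨n, rfl⟩ := h.exists_nat_pow_eq
  clear h
  induction n with
  | zero => simp
  | succ n ih => rw [pow_succ', Perm.mul_apply, hs]; exact ih

/-- The arrow configuration obtained from a choice of orientation `f` of every cycle.
[cite: BaxterKellandWu1976, §3] -/
def liftBits (σ : Perm C) (f : ↥(cycles σ) → Bool) : C → Bool :=
  fun c ↦ f ⟨PairingGenus.cls σ c, cls_mem_cycles σ c⟩

/-- `liftBits` is `σ`-invariant. [cite: BaxterKellandWu1976, §3] -/
theorem liftBits_apply_perm (σ : Perm C) (f : ↥(cycles σ) → Bool) (c : C) :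
    liftBits σ f (σ c) = liftBits σ f c := by
  unfold liftBits
  congr 2
  exact PairingGenus.cls_eq_cls_iff.2 (Perm.sameCycle_apply_left.2 (Perm.SameCycle.refl σ c))

/-- On a cycle `S`, `liftBits σ f` takes the value `f S`. [folklore] -/
theorem liftBits_apply_of_mem {σ : Perm C} (f : ↥(cycles σ) → Bool) (S : ↥(cycles σ)) {c : C}
    (hc : c ∈ S.1) : liftBits σ f c = f S := by
  unfold liftBits
  congr 1
  apply Subtype.ext
  have h := hc
  rw [← filter_cls_eq S.2, mem_filter] at h
  exact h.2

/-- `liftBits` is injective (every cycle is nonempty). [folklore] -/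
theorem liftBits_injective (σ : Perm C) : Function.Injective (liftBits σ) := by
  intro f f' h
  funext S
  obtain ⟨c, -, hc⟩ := mem_image.1 S.2
  have hcS : c ∈ S.1 := by rw [← hc]; exact PairingGenus.mem_cls_self σ c
  rw [← liftBits_apply_of_mem f S hcS, ← liftBits_apply_of_mem f' S hcS, h]

/-- **The invariant arrow configurations are exactly the orientations of the cycles.**
[cite: BaxterKellandWu1976, §3] -/
theorem filter_invariant_eq_image (σ : Perm C) :
    (univ.filter fun s : C → Bool ↦ ∀ c, s (σ c) = s c) = univ.image (liftBits σ) := by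
  classical
  ext s
  simp only [mem_filter, mem_univ, true_and, mem_image]
  constructor
  · intro hs
    refine ⟨fun S ↦ s (Classical.choose (mem_image.1 S.2)), funext fun c ↦ ?_⟩
    unfold liftBits
    have hspec := Classical.choose_spec (mem_image.1 (cls_mem_cycles σ c))
    exact apply_eq_of_sameCycle hs (PairingGenus.cls_eq_cls_iff.1 hspec.2)
  · rintro ⟨f, rfl⟩ c
    exact liftBits_apply_perm σ f c

/-! ### The orientation expansion over cycles -/

/-- `2 cos x = e^{ix} + e^{-ix}`, as the sum over an arrow bit. [folklore] -/
theorem sum_bool_exp_sgn (x : ℂ) :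
    ∑ b : Bool, Complex.exp (I * (sgn b : ℂ) * x) = 2 * Complex.cos x := by
  rw [Fintype.sum_bool, Complex.two_cos]
  simp only [sgn, if_true]
  push_cast
  ring_nf

/-- **Orientation expansion over cycles** (the combinatorial heart of Baxter–Kelland–Wu): for a
permutation `σ` of a finite set and any `g`,
`∏_{S cycle of σ} 2cos(∑_{c∈S} g c) = ∑_{s : s ∘ σ = s} ∏_c exp(i ε(s c) g c)`: write each factor
as the sum over the two orientations of its cycle and expand; an orientation of all cycles is an
invariant arrow configuration, and `∏_S ∏_{c∈S} = ∏_c`. [cite: BaxterKellandWu1976, §3] -/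
theorem prod_cycles_two_cos_eq_sum_invariant (σ : Perm C) (g : C → ℝ) :
    ∏ S ∈ cycles σ, (2 * Complex.cos (∑ c ∈ S, (g c : ℂ))) =
      ∑ s ∈ univ.filter (fun s : C → Bool ↦ ∀ c, s (σ c) = s c),
        ∏ c, Complex.exp (I * (sgn (s c) : ℂ) * g c) := by
  classical
  rw [filter_invariant_eq_image, sum_image (fun f _ f' _ h ↦ liftBits_injective σ h)]
  -- right-hand side: split the product over corners along the cycles
  have hsplit : ∀ f : ↥(cycles σ) → Bool,
      ∏ c, Complex.exp (I * (sgn (liftBits σ f c) : ℂ) * g c) =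
        ∏ S : ↥(cycles σ), Complex.exp (I * (sgn (f S) : ℂ) * ∑ c ∈ S.1, (g c : ℂ)) := by
    intro f
    rw [← prod_fiberwise_of_maps_to (g := PairingGenus.cls σ) (t := cycles σ)
      (fun c _ ↦ cls_mem_cycles σ c), ← prod_attach, univ_eq_attach]
    refine prod_congr rfl fun S _ ↦ ?_
    rw [filter_cls_eq S.2, mul_sum, Complex.exp_sum]
    refine prod_congr rfl fun c hc ↦ ?_
    rw [liftBits_apply_of_mem f S hc]
  simp_rw [hsplit]
  -- and resum cycle by cycle
  have hL : ∏ S ∈ cycles σ, (2 * Complex.cos (∑ c ∈ S, (g c : ℂ))) =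
      ∏ S : ↥(cycles σ), ∑ b ∈ (univ : Finset Bool),
        Complex.exp (I * (sgn b : ℂ) * ∑ c ∈ S.1, (g c : ℂ)) := by
    rw [← prod_coe_sort]
    exact prod_congr rfl fun S _ ↦ (sum_bool_exp_sgn _).symm
  rw [hL, prod_univ_sum, Fintype.piFinset_univ]

/-! ### The twisted loop weight `√q cos_μ` from the quarter turns (Umlaufsatz input) -/

/-- DKLM's `λ = 2πμ = arccos(√q/2)`, the half-angle of the loop weight `√q = 2cos λ`.
[cite: DuminilCopinKozlowskiLammersManolescu2026, §3.2] -/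
def lam (q : ℝ) : ℝ := Real.arccos (Real.sqrt q / 2)

/-- `λ = 2πμ`. [cite: DuminilCopinKozlowskiLammersManolescu2026, §3.2] -/
theorem lam_eq (q : ℝ) : lam q = 2 * π * dklmMu q := (two_pi_mul_dklmMu q).symm

/-- `cos λ = √q/2` for `q ≤ 4`. [cite: DuminilCopinKozlowskiLammersManolescu2026, §3.2] -/
theorem cos_lam {q : ℝ} (hq : q ≤ 4) : Real.cos (lam q) = Real.sqrt q / 2 := by
  rw [lam_eq]; exact cos_two_pi_mul_dklmMu hq

/-- `√q cos_μ(x) = 2 cos(x + λ)` for `0 < q ≤ 4`. [cite: DuminilCopinKozlowskiLammersManolescu2026, §3.2] -/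
theorem sqrt_mul_cosMu {q : ℝ} (hq0 : 0 < q) (hq : q ≤ 4) (x : ℝ) :
    Real.sqrt q * cosMu q x = 2 * Real.cos (x + lam q) := by
  have hc : Real.cos (2 * π * dklmMu q) = Real.sqrt q / 2 := cos_two_pi_mul_dklmMu hq
  have hne : Real.sqrt q ≠ 0 := (Real.sqrt_pos.2 hq0).ne'
  rw [cosMu, hc, lam_eq]
  field_simp

omit [Fintype C] [DecidableEq C] in
/-- The sense of rotation `τ_S = (∑_{c∈S} t c)/4` of a cycle from its quarter turns (`±1` when the
turns sum to `±4`). [cite: BaxterKellandWu1976, §3] -/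
def cycleSign (t : C → ℤ) (S : Finset C) : ℝ := (∑ c ∈ S, t c : ℤ) / 4

omit [Fintype C] [DecidableEq C] in
/-- **From quarter turns to the twisted loop weight**: if the quarter turns of the cycle `S` sum
to `±4` (Umlaufsatz), then for `g = λ t/4 + κ`,
`2cos(∑_{c∈S} g c) = √q cos_μ(τ_S ∑_{c∈S} κ c)` — the two orientations of the loop carry
`e^{±iλ}` (from `e^{±iλ/4}` per turn) times `e^{±i θ̃_S}`. [cite: BaxterKellandWu1976, §4] -/
theorem two_cos_eq_sqrt_mul_cosMu {q : ℝ} (hq0 : 0 < q) (hq : q ≤ 4) {t : C → ℤ} {S : Finset C}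
    (ht : ∑ c ∈ S, t c = 4 ∨ ∑ c ∈ S, t c = -4) (κ : C → ℝ) :
    2 * Real.cos (∑ c ∈ S, (lam q / 4 * t c + κ c)) =
      Real.sqrt q * cosMu q (cycleSign t S * ∑ c ∈ S, κ c) := by
  rw [sqrt_mul_cosMu hq0 hq, sum_add_distrib, ← mul_sum, cycleSign]
  have hcast : (∑ c ∈ S, (t c : ℝ)) = ((∑ c ∈ S, t c : ℤ) : ℝ) := by push_cast; rfl
  rw [hcast]
  rcases ht with h | h <;> rw [h] <;> push_cast
  · ring_nf
  · rw [show lam q / 4 * -4 + ∑ c ∈ S, κ c = -(-4 / 4 * ∑ c ∈ S, κ c + lam q) by ring, Real.cos_neg]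

/-- **Product form**: `√q^{#cycles} ∏_S cos_μ(τ_S θ̃_S) = ∏_S 2cos(∑_{c∈S} (λ t/4 + κ))`.
[cite: BaxterKellandWu1976, §4] -/
theorem sqrt_pow_mul_prod_cosMu {q : ℝ} (hq0 : 0 < q) (hq : q ≤ 4) (σ : Perm C) {t : C → ℤ}
    (ht : ∀ S ∈ cycles σ, ∑ c ∈ S, t c = 4 ∨ ∑ c ∈ S, t c = -4) (κ : C → ℝ) :
    Real.sqrt q ^ PairingGenus.ncl σ * ∏ S ∈ cycles σ, cosMu q (cycleSign t S * ∑ c ∈ S, κ c) =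
      ∏ S ∈ cycles σ, 2 * Real.cos (∑ c ∈ S, (lam q / 4 * t c + κ c)) := by
  rw [ncl_eq_card_cycles, ← prod_const, ← prod_mul_distrib]
  exact prod_congr rfl fun S hS ↦ (two_cos_eq_sqrt_mul_cosMu hq0 hq (ht S hS) κ).symm

/-! ### Summing over configurations: the six-vertex weight -/

section Configurations

variable {Ξ : Type*}

/-- **The six-vertex weight of an arrow configuration `s`** collected from the loop expansion:
the sum, over the configurations `ξ` whose loops are compatible with `s` (`s ∘ σ_ξ = s`), of the
product of the turn phases `exp(i ε(s c) λ t_ξ(c) / 4)` (`e^{±iλ/4}` per left/right quarter turn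
of the oriented loop). On `ℤ²` this is the product of the local six-vertex weights
`1, 1, 1, 1, c, c`, `c = 2cos(λ/2)`. [cite: BaxterKellandWu1976, §4] -/
def bkwWeight (T : Finset Ξ) (σ : Ξ → Perm C) (t : Ξ → C → ℤ) (q : ℝ) (s : C → Bool) : ℂ :=
  ∑ ξ ∈ T with (∀ c, s (σ ξ c) = s c), ∏ c, Complex.exp (I * (sgn (s c) : ℂ) * (lam q / 4 * t ξ c))

/-- **The Baxter–Kelland–Wu identity, configuration form.** For configurations `ξ ∈ T` with
loops the cycles of `σ_ξ` and quarter turns `t_ξ` summing to `±4` around every loop, and any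
corner functional `κ` (`θ̃_S = ∑_{c∈S} κ c`, e.g. the pairing of the winding number of the loop
with a test function), for `0 < q ≤ 4`:
`∑_ξ √q^{#loops ξ} ∏_{S} cos_μ(τ_S θ̃_S) = ∑_{s : C → Bool} W(s) exp(i ∑_c ε(s c) κ c)`.
[cite: DuminilCopinKozlowskiLammersManolescu2026, §3.2 (3.2)] -/
theorem bkw_configuration_sum {q : ℝ} (hq0 : 0 < q) (hq : q ≤ 4) (T : Finset Ξ) (σ : Ξ → Perm C)
    (t : Ξ → C → ℤ)
    (ht : ∀ ξ ∈ T, ∀ S ∈ cycles (σ ξ), ∑ c ∈ S, t ξ c = 4 ∨ ∑ c ∈ S, t ξ c = -4) (κ : C → ℝ) :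
    ((∑ ξ ∈ T, Real.sqrt q ^ PairingGenus.ncl (σ ξ) *
        ∏ S ∈ cycles (σ ξ), cosMu q (cycleSign (t ξ) S * ∑ c ∈ S, κ c) : ℝ) : ℂ) =
      ∑ s : C → Bool, bkwWeight T σ t q s * Complex.exp (I * ∑ c, (sgn (s c) : ℂ) * κ c) := by
  classical
  -- each configuration: loop weight → orientation expansion
  have hξ : ∀ ξ ∈ T, ((Real.sqrt q ^ PairingGenus.ncl (σ ξ) *
      ∏ S ∈ cycles (σ ξ), cosMu q (cycleSign (t ξ) S * ∑ c ∈ S, κ c) : ℝ) : ℂ) =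
      ∑ s ∈ univ.filter (fun s : C → Bool ↦ ∀ c, s (σ ξ c) = s c),
        ∏ c, Complex.exp (I * (sgn (s c) : ℂ) * ((lam q / 4 * t ξ c + κ c : ℝ) : ℂ)) := by
    intro ξ hξT
    rw [sqrt_pow_mul_prod_cosMu hq0 hq (σ ξ) (ht ξ hξT) κ, ← prod_cycles_two_cos_eq_sum_invariant]
    push_cast
    rfl
  rw [Complex.ofReal_sum, sum_congr rfl hξ]
  -- swap the sums and split the phases
  simp_rw [sum_filter]
  rw [sum_comm]
  refine sum_congr rfl fun s _ ↦ ?_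
  rw [bkwWeight, sum_filter, sum_mul]
  refine sum_congr rfl fun ξ _ ↦ ?_
  split_ifs with hs
  · rw [mul_sum, Complex.exp_sum, ← prod_mul_distrib]
    refine prod_congr rfl fun c _ ↦ ?_
    rw [← Complex.exp_add]
    push_cast
    ring_nf
  · rw [zero_mul]

end Configurations

end Literature.Probability.Percolation.BKW

end
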